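import Literature.Geometry.DiscreteGeometry.KissingSearchRelabel
import HarnessLib

/-!
# Soundness of the growth search: `search = true` forces the FCC / HCP contact graph

Topic `Literature/Geometry/DiscreteGeometry`; provefact brick for `Hales2012_contactGraphTame` /
`Hales2012_contactGraphFccOrHcp`, part 7.  Everything here is PROVED; nothing is named.

* Part A — the bookkeeping of the search: `chooseOpen`, `newLabel`, `widest`, `isoTo`,
  `nused`, and relabelling a realized state by a swap of two unused labels;
* Part B — a state without open sides has every triangle placed (connectivity), hence twenty
  triangles on twelve labels, and its decided contact graph is the contact graph of `M`;
  **`accept_sound`**; **`refute_sound`**;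
* Part C — **`search_sound`**: if `s.search dirty fuel = true` for a realized state `s` with a
  placed triangle, then `M.Concl` (by induction on `fuel`, growing at the chosen open side over
  every admissible third vertex, the new-label case by the swap relabelling).

## References
* T. C. Hales, arXiv:1209.6043 (2012), Theorem 3, Lemmas 8–9. [`Hales2012`]
* R. E. Moore, *Interval Analysis* (1966), §4.4. [`Moore1966`]
-/

namespace Literature.Geometry.DiscreteGeometry

namespace KissingSearch

open Real Literature.Analysis.ValidatedNumerics KissingLP NonemptyInterval Finset

/-! ### Part A. Bookkeeping -/

section Book

variable {M : KConf} {s : St}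

/-- **Meaning of `chooseOpen = some`**: an open side `{v, a}` (exactly one placed triangle,
`{v, a, b}`). [folklore] -/
theorem chooseOpen_some (hR : Realizes M s) {v a b : ℕ} (h : s.chooseOpen = some (v, a, b)) :
    v < 12 ∧ a < 12 ∧ a ≠ v ∧ s.gsc v a = 1 ∧ ∃ t ∈ s.tris.toList, tset t = {v, a, b} ∧ b < 12 ∧ b ≠ v ∧ b ≠ a := by
  unfold St.chooseOpen at h
  obtain ⟨v', hv', hf⟩ := List.exists_of_findSome?_eq_some h
  rw [List.mem_range] at hv'
  revert hf
  cases hfind : (List.range 12).find? (fun a => a != v' && s.gsc v' a == 1) with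
  | none => intro hf; cases hf
  | some a' =>
    simp only
    have hp := List.find?_some hfind
    have ha' := List.mem_of_find?_eq_some hfind
    rw [List.mem_range] at ha'
    simp only [Bool.and_eq_true, bne_iff_ne, ne_eq, beq_iff_eq] at hp
    cases hap : s.apexes v' a' with
    | nil => intro hf; cases hf
    | cons b' rest =>
      simp only
      intro hf
      cases hf
      refine ⟨hv', ha', hp.1, hp.2, ?_⟩
      have hb : b ∈ s.apexes v a := by rw [hap]; simp
      rw [apexes_eq, List.mem_reverse, List.mem_map] at hb
      obtain ⟨t, ht, hbt⟩ := hb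
      rw [List.mem_filter] at ht
      simp only [Bool.and_eq_true] at ht
      have hvt := tmem_iff.1 ht.2.1
      have hat := tmem_iff.1 ht.2.2
      obtain ⟨hm, h1, h2, hset⟩ := third_vertex (hR.valid t ht.1) hvt hat (Ne.symm hp.1)
      rw [hbt] at hm h1 h2 hset
      exact ⟨t, ht.1, hset, lt_of_mem_tset (hR.valid t ht.1) hm, h1, h2⟩

/-- **Meaning of `chooseOpen = none`**: no side lies in exactly one placed triangle. [folklore] -/
theorem chooseOpen_none (hR : Realizes M s) (h : s.chooseOpen = none) {v a : ℕ} (hv : v < 12) (ha : a < 12)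
    (hav : a ≠ v) : s.gsc v a ≠ 1 := by
  intro h1
  unfold St.chooseOpen at h
  rw [List.findSome?_eq_none_iff] at h
  have hfv := h v (List.mem_range.2 hv)
  revert hfv
  cases hfind : (List.range 12).find? (fun a => a != v && s.gsc v a == 1) with
  | none =>
    intro _
    rw [List.find?_eq_none] at hfind
    have := hfind a (List.mem_range.2 ha)
    simp only [Bool.and_eq_true, bne_iff_ne, ne_eq, beq_iff_eq, not_and] at this
    exact this hav h1
  | some a' =>
    simp only
    have hp := List.find?_some hfind
    have ha' := List.mem_of_find?_eq_some hfind
    rw [List.mem_range] at ha'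
    simp only [Bool.and_eq_true, bne_iff_ne, ne_eq, beq_iff_eq] at hp
    -- `apexes v a'` is nonempty
    have hne : s.apexes v a' ≠ [] := by
      rw [apexes_eq]
      intro he
      rw [List.reverse_eq_nil_iff, List.map_eq_nil_iff] at he
      have hl := gsc_eq_length hR hv ha' (Ne.symm hp.1)
      rw [hp.2] at hl
      unfold St.onSideL at hl
      rw [he] at hl
      simp at hl
    cases hap : s.apexes v a' with
    | nil => exact absurd hap hne
    | cons b rest => simp

/-- **Meaning of `newLabel`.** [folklore] -/
theorem newLabel_some {n : ℕ} (h : s.newLabel = some n) : n < 12 ∧ s.hdeg2 n = 0 := by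
  unfold St.newLabel at h
  have h1 := List.find?_some h
  have h2 := List.mem_of_find?_eq_some h
  rw [List.mem_range] at h2
  simp only [beq_iff_eq] at h1
  exact ⟨h2, h1⟩

/-- `newLabel = none` means every label is used. [folklore] -/
theorem newLabel_none (h : s.newLabel = none) {n : ℕ} (hn : n < 12) : s.hdeg2 n ≠ 0 := by
  unfold St.newLabel at h
  rw [List.find?_eq_none] at h
  have := h n (List.mem_range.2 hn)
  simpa using this

/-- **Meaning of `widest = some`**: a long side lying in a placed triangle, with a range of at
least two cells. [folklore] -/
theorem widest_some {a b : ℕ} (h : s.widest = some (a, b)) :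
    a < b ∧ b < 12 ∧ s.gdom a b ≠ 0 ∧ s.gdom a b ≠ UNL ∧ s.gsc a b ≠ 0 ∧ rLo (s.gdom a b) < rHi (s.gdom a b) := by
  unfold St.widest at h
  rw [foldRange_eq_foldl] at h
  -- the property of a record
  set P : ℕ × ℕ × ℕ → Prop := fun x => x.2.1 < x.2.2 ∧ x.2.2 < 12 ∧ s.gdom x.2.1 x.2.2 ≠ 0 ∧ s.gdom x.2.1 x.2.2 ≠ UNL ∧
    s.gsc x.2.1 x.2.2 ≠ 0 ∧ rLo (s.gdom x.2.1 x.2.2) < rHi (s.gdom x.2.1 x.2.2) with hP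
  set F := (fun (best : Option (ℕ × ℕ × ℕ)) (i : ℕ) =>
    let a := i / 12
    let b := i % 12
    if ¬ a < b then best
    else
      let r := s.gdom a b
      if r = 0 ∨ r = UNL ∨ s.gsc a b = 0 then best
      else
        let w := rHi r - rLo r
        if w = 0 then best
        else match best with
          | none => some (w, a, b)
          | some (w', _, _) => if w' < w then some (w, a, b) else best) with hF
  -- one step produces the old record or a good new one
  have hstep : ∀ (best : Option (ℕ × ℕ × ℕ)) (i : ℕ) (x : ℕ × ℕ × ℕ), F best i = some x → best = some x ∨ P x := by
    intro best i x h
    simp only [hF] at h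
    by_cases c1 : ¬ i / 12 < i % 12
    · rw [if_pos c1] at h; exact Or.inl h
    · rw [if_neg c1] at h
      by_cases c2 : s.gdom (i / 12) (i % 12) = 0 ∨ s.gdom (i / 12) (i % 12) = UNL ∨ s.gsc (i / 12) (i % 12) = 0
      · rw [if_pos c2] at h; exact Or.inl h
      · rw [if_neg c2] at h
        by_cases c3 : rHi (s.gdom (i / 12) (i % 12)) - rLo (s.gdom (i / 12) (i % 12)) = 0
        · rw [if_pos c3] at h; exact Or.inl h
        · rw [if_neg c3] at h
          simp only [not_or] at c2
          have good : P (rHi (s.gdom (i / 12) (i % 12)) - rLo (s.gdom (i / 12) (i % 12)), i / 12, i % 12) := by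
            rw [hP]
            show i / 12 < i % 12 ∧ i % 12 < 12 ∧ s.gdom (i / 12) (i % 12) ≠ 0 ∧ s.gdom (i / 12) (i % 12) ≠ UNL ∧
              s.gsc (i / 12) (i % 12) ≠ 0 ∧ rLo (s.gdom (i / 12) (i % 12)) < rHi (s.gdom (i / 12) (i % 12))
            exact ⟨not_not.1 c1, Nat.mod_lt _ (by norm_num), c2.1, c2.2.1, c2.2.2, by omega⟩
          cases best with
          | none =>
            right
            simp only [Option.some.injEq] at h
            rw [← h]; exact good
          | some p =>
            obtain ⟨w', a', b'⟩ := p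
            simp only at h
            split_ifs at h with c4
            · right; simp only [Option.some.injEq] at h; rw [← h]; exact good
            · exact Or.inl h
  -- the fold keeps "none or good"
  have inv : ∀ (L : List ℕ) (best : Option (ℕ × ℕ × ℕ)), (∀ x, best = some x → P x) →
      ∀ x, L.foldl F best = some x → P x := by
    intro L
    induction L with
    | nil => intro best hb x hx; exact hb x hx
    | cons i L ih =>
      intro best hb x hx
      rw [List.foldl_cons] at hx
      refine ih _ (fun y hy => ?_) x hx
      rcases hstep best i y hy with h' | h'
      · exact hb y h'
      · exact h'
  revert h
  cases hfold : (List.range' 0 144).foldl F none with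
  | none => intro h; cases h
  | some x =>
    obtain ⟨w, a', b'⟩ := x
    intro h
    simp only [Option.map_some, Option.some.injEq, Prod.mk.injEq] at h
    obtain ⟨rfl, rfl⟩ := h
    have := inv _ none (fun y hy => by cases hy) _ hfold
    rw [hP] at this
    exact this

/-- **Meaning of `nused`.** [folklore] -/
theorem nused_eq (s : St) : s.nused = ((List.range' 0 12).filter fun v => s.hdeg2 v ≠ 0).length := by
  unfold St.nused
  rw [foldRange_eq_foldl]
  suffices h : ∀ (L : List ℕ) (n : ℕ),
      L.foldl (fun n v => if s.hdeg2 v = 0 then n else n + 1) n = n + (L.filter fun v => s.hdeg2 v ≠ 0).length by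
    simpa using h (List.range' 0 12) 0
  intro L
  induction L with
  | nil => intro n; simp
  | cons v L ih =>
    intro n
    rw [List.foldl_cons, ih, List.filter_cons]
    by_cases h : s.hdeg2 v = 0
    · rw [if_pos h, if_neg (by simp [h])]
    · rw [if_neg h, if_pos (by simp [h]), List.length_cons]; omega

/-- **Relabelling a realized state by a swap of two unused labels.** [folklore] -/
theorem realizes_swap (hR : Realizes M s) {c n : ℕ} (hc : c < 12) (hn : n < 12)
    (hcu : ∀ t ∈ s.tris.toList, c ∉ tset t) (hnu : ∀ t ∈ s.tris.toList, n ∉ tset t) :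
    Realizes (M.relabel (Equiv.swap c n) (fun a => by
      by_cases h1 : a = c
      · subst h1; rw [Equiv.swap_apply_left]; exact ⟨fun _ => hc, fun _ => hn⟩
      · by_cases h2 : a = n
        · subst h2; rw [Equiv.swap_apply_right]; exact ⟨fun _ => hn, fun _ => hc⟩
        · rw [Equiv.swap_apply_of_ne_of_ne h1 h2])) s := by
  have fix : ∀ t ∈ s.tris.toList, relab (Equiv.swap c n) (tset t) = tset t := by
    intro t ht
    unfold relab
    have : ∀ x ∈ tset t, (Equiv.swap c n) x = x := fun x hx =>
      Equiv.swap_apply_of_ne_of_ne (fun e => hcu t ht (e ▸ hx)) (fun e => hnu t ht (e ▸ hx))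
    ext x
    rw [Finset.mem_image]
    constructor
    · rintro ⟨y, hy, rfl⟩; rw [this y hy]; exact hy
    · intro hx; exact ⟨x, hx, this x hx⟩
  -- labelled pairs avoid `c` and `n`
  have fixlab : ∀ p q, p < 12 → q < 12 → p ≠ q → s.gdom p q ≠ UNL →
      (Equiv.swap c n) p = p ∧ (Equiv.swap c n) q = q := by
    intro p q hp hq hpq hl
    obtain ⟨t, ht, hpt, hqt⟩ := hR.lab_side p q hp hq hpq hl
    exact ⟨Equiv.swap_apply_of_ne_of_ne (fun e => hcu t ht (e ▸ hpt)) (fun e => hnu t ht (e ▸ hpt)),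
      Equiv.swap_apply_of_ne_of_ne (fun e => hcu t ht (e ▸ hqt)) (fun e => hnu t ht (e ▸ hqt))⟩
  exact {
    size_dom := hR.size_dom
    size_sc := hR.size_sc
    valid := hR.valid
    mem := fun t ht => by
      show tset t ∈ M.T.image (relab (Equiv.swap c n))
      rw [Finset.mem_image]
      exact ⟨tset t, hR.mem t ht, fix t ht⟩
    nodup := hR.nodup
    sc_eq := hR.sc_eq
    dom := fun p q hp hq hpq => by
      show DomSem (s.gdom p q) (M.g ((Equiv.swap c n).symm p) ((Equiv.swap c n).symm q))
      rw [Equiv.symm_swap]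
      by_cases hl : s.gdom p q = UNL
      · exact Or.inl hl
      · obtain ⟨e1, e2⟩ := fixlab p q hp hq hpq hl
        rw [e1, e2]; exact hR.dom p q hp hq hpq
    lab_side := hR.lab_side
    side_lab := hR.side_lab }

end Book

/-! ### Part B. Complete states: accept and refute -/

section Complete

variable {M : KConf} {s : St}

/-- **No open side forces every triangle to be placed** (given one placed triangle).
[cite: Hales2012, proof of Lemma 9] -/
theorem all_placed_of_no_open (hR : Realizes M s) (hno : ∀ v, v < 12 → ∀ a, a < 12 → a ≠ v → s.gsc v a ≠ 1)
    (hne : s.tris.toList ≠ []) {t'' : Finset ℕ} (hT : t'' ∈ M.T) : ∃ t ∈ s.tris.toList, tset t = t'' := by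
  classical
  set D := (Finset.range 12).filter fun x => ∃ t ∈ s.tris.toList, x ∈ tset t with hD
  have hDsub : D ⊆ Finset.range 12 := Finset.filter_subset _ _
  obtain ⟨t₀, ht₀⟩ := List.exists_mem_of_ne_nil _ hne
  have hDne : D.Nonempty := ⟨tv0 t₀, by
    rw [hD, Finset.mem_filter, Finset.mem_range]
    have h0 : tv0 t₀ ∈ tset t₀ := by unfold tset; simp
    exact ⟨lt_of_mem_tset (hR.valid t₀ ht₀) h0, t₀, ht₀, h0⟩⟩
  have hcl : ∀ t ∈ M.T, (∃ a ∈ t, a ∈ D) → t ⊆ D := by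
    intro t ht ⟨x, hxt, hxD⟩
    rw [hD, Finset.mem_filter, Finset.mem_range] at hxD
    obtain ⟨hx12, tp, htp, hxp⟩ := hxD
    obtain ⟨t₁, ht₁, e⟩ := all_placed_of_closed hR hx12 (fun u hu huv => hno x hx12 u hu huv) htp hxp ht hxt
    intro y hy
    rw [hD, Finset.mem_filter, Finset.mem_range]
    exact ⟨(M.mem_T t ht).2 y hy, t₁, ht₁, by rw [e]; exact hy⟩
  have hDeq := M.conn D hDsub hDne hcl
  obtain ⟨hc3, hlt⟩ := M.mem_T t'' hT
  obtain ⟨x, hx⟩ : t''.Nonempty := by rw [← Finset.card_pos, hc3]; norm_num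
  have hxD : x ∈ D := by rw [hDeq, Finset.mem_range]; exact hlt x hx
  rw [hD, Finset.mem_filter, Finset.mem_range] at hxD
  obtain ⟨hx12, tp, htp, hxp⟩ := hxD
  exact all_placed_of_closed hR hx12 (fun u hu huv => hno x hx12 u hu huv) htp hxp hT hx

/-- The placed triangles form a subset of `M.T` of the same size as the placed list.
[folklore] -/
theorem card_image_tris (hR : Realizes M s) :
    (s.tris.toList.map tset).toFinset ⊆ M.T ∧ (s.tris.toList.map tset).toFinset.card = s.tris.size := by
  constructor
  · intro t'' ht''
    rw [List.mem_toFinset, List.mem_map] at ht''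
    obtain ⟨t, ht, rfl⟩ := ht''
    exact hR.mem t ht
  · rw [List.card_toFinset, List.dedup_eq_self.2, List.length_map, Array.length_toList]
    exact (List.nodup_map_iff_inj_on hR.nodup).2 fun t ht t' ht' e => eq_of_tset_eq (hR.valid t ht) (hR.valid t' ht') e

/-- **An unplaced triangle of `M` bounds the number of placed ones by `19`.** [folklore] -/
theorem size_lt_of_unplaced (hR : Realizes M s) {t'' : Finset ℕ} (hT : t'' ∈ M.T)
    (hun : ∀ t ∈ s.tris.toList, tset t ≠ t'') : s.tris.size < 20 := by
  obtain ⟨hsub, hcard⟩ := card_image_tris hR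
  have hss : (s.tris.toList.map tset).toFinset ⊂ M.T := by
    refine Finset.ssubset_iff_subset_ne.2 ⟨hsub, fun e => ?_⟩
    have : t'' ∈ (s.tris.toList.map tset).toFinset := by rw [e]; exact hT
    rw [List.mem_toFinset, List.mem_map] at this
    obtain ⟨t, ht, e'⟩ := this
    exact hun t ht e'
  have := Finset.card_lt_card hss
  rw [hcard, M.card_T] at this
  exact this

/-- **A complete state has twenty triangles on twelve labels.** [folklore] -/
theorem size_and_nused_of_complete (hR : Realizes M s) (hall : ∀ t'' ∈ M.T, ∃ t ∈ s.tris.toList, tset t = t'') :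
    s.tris.size = 20 ∧ s.nused = 12 := by
  classical
  obtain ⟨hsub, hcard⟩ := card_image_tris hR
  have heq : (s.tris.toList.map tset).toFinset = M.T := by
    refine Finset.Subset.antisymm hsub fun t'' ht'' => ?_
    obtain ⟨t, ht, rfl⟩ := hall t'' ht''
    rw [List.mem_toFinset, List.mem_map]; exact ⟨t, ht, rfl⟩
  refine ⟨by rw [← hcard, heq, M.card_T], ?_⟩
  rw [nused_eq]
  have : (List.range' 0 12).filter (fun v => s.hdeg2 v ≠ 0) = List.range' 0 12 := by
    rw [List.filter_eq_self]
    intro v hv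
    rw [List.mem_range'_1] at hv
    obtain ⟨t'', hT, hv''⟩ := M.cover v (by omega)
    obtain ⟨t, ht, e⟩ := hall t'' hT
    have h := (used_iff_hdeg2 hR (by omega : v < 12)).1 ⟨t, ht, by rw [e]; exact hv''⟩
    simpa using h
  rw [this, List.length_range']

/-- **The decided contact graph of a complete state is the contact graph of `M`.**
[folklore] -/
theorem adjB_iff (hR : Realizes M s) (hall : ∀ t'' ∈ M.T, ∃ t ∈ s.tris.toList, tset t = t'') {a b : ℕ}
    (ha : a < 12) (hb : b < 12) : s.adjB a b = true ↔ (a ≠ b ∧ M.g a b = 1 / 2) := by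
  unfold St.adjB
  simp only [Bool.and_eq_true, bne_iff_ne, ne_eq, beq_iff_eq]
  constructor
  · rintro ⟨⟨hab, -⟩, h0⟩
    refine ⟨hab, ?_⟩
    rcases hR.dom a b ha hb hab with h | ⟨-, h⟩ | ⟨-, h, -⟩
    · rw [h0] at h; exact absurd h (by unfold UNL; norm_num)
    · exact h
    · exact absurd h0 h
  · rintro ⟨hab, hg⟩
    obtain ⟨t'', hT, hat, hbt⟩ := M.contact_side a b ha hb hab hg
    obtain ⟨t, ht, e⟩ := hall t'' hT
    have hat' : a ∈ tset t := by rw [e]; exact hat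
    have hbt' : b ∈ tset t := by rw [e]; exact hbt
    have hsc : s.gsc a b ≠ 0 := by
      rw [gsc_eq_length hR ha hb hab]
      intro h0
      have : t ∈ s.onSideL a b := by
        unfold St.onSideL; rw [List.mem_filter]; simp only [Bool.and_eq_true]
        exact ⟨ht, tmem_iff.2 hat', tmem_iff.2 hbt'⟩
      rw [List.length_eq_zero_iff.1 h0] at this; simp at this
    refine ⟨⟨hab, hsc⟩, ?_⟩
    have hl := hR.side_lab t ht a hat' b hbt' hab
    rcases hR.dom a b ha hb hab with h | ⟨h, -⟩ | ⟨-, -, h, -⟩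
    · exact absurd h hl
    · exact h
    · exact absurd hg h

/-- **Soundness of `isoTo`.** [cite: Hales2012, Lemma 9] -/
theorem concl_of_isoTo (hR : Realizes M s) (hall : ∀ t'' ∈ M.T, ∃ t ∈ s.tris.toList, tset t = t'')
    {i : Fin 8} (hi : i = 0 ∨ i = 1) {perm : List ℕ} (h : s.isoTo i perm = true) : M.Concl := by
  unfold St.isoTo at h
  simp only [Bool.and_eq_true, beq_iff_eq, List.all_eq_true, List.mem_range, Bool.or_eq_true, bne_iff_ne,
    ne_eq] at h
  obtain ⟨⟨-, hinj⟩, hadj⟩ := h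
  -- every image is `< 12`
  have hlt : ∀ a, a < 12 → perm.getD a 12 < 12 := by
    intro a ha
    have := hadj a ha a ha
    split_ifs at this with hh
    exact hh.1
  let f : Fin 12 → Fin 12 := fun a => ⟨perm.getD a 12, hlt a a.2⟩
  have hf : Function.Injective f := by
    intro a b e
    have e' : perm.getD a 12 = perm.getD b 12 := by simpa [f] using congrArg Fin.val e
    by_contra hab
    have := hinj a a.2 b b.2
    rcases this with h | h
    · exact hab (Fin.ext h)
    · exact h e'
  have hfb : Function.Bijective f := (Finite.injective_iff_bijective).1 hf
  refine ⟨i, hi, Equiv.ofBijective f hfb, fun a b => ?_⟩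
  have h := hadj a a.2 b b.2
  rw [dif_pos ⟨hlt a a.2, hlt b b.2⟩] at h
  rw [← adjB_iff hR hall a.2 b.2]
  have h' := beq_iff_eq.1 h
  show s.adjB a b = true ↔ tameAdjM i (f a) (f b) = true
  rw [h']

/-- **Soundness of `accept`.** [cite: Hales2012, Lemma 9] -/
theorem accept_sound (hR : Realizes M s) (hall : ∀ t'' ∈ M.T, ∃ t ∈ s.tris.toList, tset t = t'')
    (h : s.accept = true) : M.Concl := by
  unfold St.accept at h
  revert h
  cases s.findIso 1 20 [] with
  | some p => intro h; exact concl_of_isoTo hR hall (Or.inr rfl) h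
  | none =>
    simp only
    cases s.findIso 0 20 [] with
    | some p => intro h; exact concl_of_isoTo hR hall (Or.inl rfl) h
    | none => intro h; cases h

/-- Decoding `mkR` (lower cell). [folklore] -/
theorem rLo_mkR {lo hi : ℕ} (h : hi < 16) : rLo (mkR lo hi) = lo := by unfold rLo mkR; omega

/-- Decoding `mkR` (upper cell). [folklore] -/
theorem rHi_mkR {lo hi : ℕ} (h : hi < 16) : rHi (mkR lo hi) = hi := by unfold rHi mkR; omega

/-- **Soundness of `refute`**: a realized state is never refuted. [cite: Moore1966, §4.4] -/
theorem refute_sound (fuel : ℕ) : ∀ (s : St), Realizes M s → s.refute fuel = true → False := by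
  induction fuel with
  | zero => intro s _ h; simp [St.refute] at h
  | succ fuel ih =>
    intro s hR h
    rw [St.refute] at h
    obtain ⟨n1, k1⟩ := propagate_sound hR 300
    revert h
    cases hp : s.propagate 300 with
    | none => exact absurd hp n1
    | some s₁ =>
      obtain ⟨hR1, -⟩ := k1 s₁ hp
      simp only
      cases hw : s₁.widest with
      | none => intro h; cases h
      | some p =>
        obtain ⟨a, b⟩ := p
        simp only [Bool.and_eq_true]
        rintro ⟨h1, h2⟩
        obtain ⟨hab, hb, hr0, hrU, -, hw'⟩ := widest_some hw
        have ha : a < 12 := by omega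
        rcases hR1.dom a b ha hb (ne_of_lt hab) with h | ⟨h, -⟩ | ⟨vd, -, hxne, hxlo, hxhi⟩
        · exact hrU h
        · exact hr0 h
        rcases vd with h | ⟨hl1, hl2, hl3, -⟩
        · exact hr0 h
        have hm1 : rLo (s₁.gdom a b) ≤ (rLo (s₁.gdom a b) + rHi (s₁.gdom a b)) / 2 := by omega
        have hm2 : (rLo (s₁.gdom a b) + rHi (s₁.gdom a b)) / 2 < rHi (s₁.gdom a b) := by omega
        have hK : K = 15 := rfl
        by_cases hx : M.g a b ≤ ((gridPt ((rLo (s₁.gdom a b) + rHi (s₁.gdom a b)) / 2) : ℚ) : ℝ)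
        · refine ih _ (hR1.sdom ha hb (ne_of_lt hab) hrU ?_ ?_) h1
          · unfold mkR UNL; omega
          · have v1 : ValidDom (mkR (rLo (s₁.gdom a b)) ((rLo (s₁.gdom a b) + rHi (s₁.gdom a b)) / 2)) :=
              validDom_mkR hl1 hm1 (by omega)
            have elo : rLo (mkR (rLo (s₁.gdom a b)) ((rLo (s₁.gdom a b) + rHi (s₁.gdom a b)) / 2)) = rLo (s₁.gdom a b) :=
              rLo_mkR (by omega)
            have ehi : rHi (mkR (rLo (s₁.gdom a b)) ((rLo (s₁.gdom a b) + rHi (s₁.gdom a b)) / 2)) =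
                (rLo (s₁.gdom a b) + rHi (s₁.gdom a b)) / 2 := rHi_mkR (by omega)
            exact Or.inr (Or.inr ⟨v1, by unfold mkR; omega, hxne, by rw [elo]; exact hxlo, by rw [ehi]; exact hx⟩)
        · refine ih _ (hR1.sdom ha hb (ne_of_lt hab) hrU ?_ ?_) h2
          · unfold mkR UNL; omega
          · have v1 : ValidDom (mkR ((rLo (s₁.gdom a b) + rHi (s₁.gdom a b)) / 2 + 1) (rHi (s₁.gdom a b))) :=
              validDom_mkR (by omega) (by omega) hl3
            have elo : rLo (mkR ((rLo (s₁.gdom a b) + rHi (s₁.gdom a b)) / 2 + 1) (rHi (s₁.gdom a b))) =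
                (rLo (s₁.gdom a b) + rHi (s₁.gdom a b)) / 2 + 1 := rLo_mkR (by omega)
            have ehi : rHi (mkR ((rLo (s₁.gdom a b) + rHi (s₁.gdom a b)) / 2 + 1) (rHi (s₁.gdom a b))) = rHi (s₁.gdom a b) :=
              rHi_mkR (by omega)
            refine Or.inr (Or.inr ⟨v1, by unfold mkR; omega, hxne, ?_, by rw [ehi]; exact hxhi⟩)
            rw [elo, Nat.add_sub_cancel]
            exact (not_le.1 hx).le

end Complete

/-! ### Part C. The search -/

section Search

/-- The third vertex of the missing triangle on an open side. [folklore] -/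
theorem exists_third {M : KConf} {s : St} (hR : Realizes M s) {v a b : ℕ} (hv : v < 12) (ha : a < 12)
    (hav : a ≠ v) (h1 : s.gsc v a = 1) {t₀ : ℕ} (ht₀ : t₀ ∈ s.tris.toList) (hset₀ : tset t₀ = {v, a, b}) :
    ∃ c, c < 12 ∧ c ≠ v ∧ c ≠ a ∧ c ≠ b ∧ ({v, a, c} : Finset ℕ) ∈ M.T ∧
      ∀ t ∈ s.tris.toList, tset t ≠ {v, a, c} := by
  classical
  obtain ⟨t'', hT, hv'', ha'', hun⟩ := exists_unplaced_of_gsc_one hR hv ha (Ne.symm hav) h1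
  obtain ⟨hc3, hlt⟩ := M.mem_T t'' hT
  have hva : ({v, a} : Finset ℕ) ⊆ t'' := by
    intro x hx; simp only [Finset.mem_insert, Finset.mem_singleton] at hx
    rcases hx with rfl | rfl
    · exact hv''
    · exact ha''
  have hcard : (t'' \ {v, a}).card = 1 := by
    rw [Finset.card_sdiff_of_subset hva, hc3, Finset.card_pair (Ne.symm hav)]
  obtain ⟨c, hc⟩ := Finset.card_eq_one.1 hcard
  have hcm : c ∈ t'' \ {v, a} := by rw [hc]; simp
  rw [Finset.mem_sdiff] at hcm
  obtain ⟨hct, hcva⟩ := hcm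
  simp only [Finset.mem_insert, Finset.mem_singleton, not_or] at hcva
  have heq : t'' = {v, a, c} := by
    have : t'' = {v, a} ∪ (t'' \ {v, a}) := (Finset.union_sdiff_of_subset hva).symm
    rw [this, hc]
    ext x; simp only [Finset.mem_union, Finset.mem_insert, Finset.mem_singleton]; tauto
  refine ⟨c, hlt c hct, hcva.1, hcva.2, ?_, heq ▸ hT, fun t ht e => hun t ht (by rw [e, heq])⟩
  rintro rfl
  exact hun t₀ ht₀ (by rw [hset₀, heq])

/-- **The root normalisation is invariant under a swap fixing `0, …, 4`.** [folklore] -/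
theorem rootInv_relabel_swap (M : KConf) {c n : ℕ} (hc5 : 5 ≤ c) (hn5 : 5 ≤ n)
    (hσ : ∀ a, (Equiv.swap c n) a < 12 ↔ a < 12) (hI : M.RootInv) : (M.relabel (Equiv.swap c n) hσ).RootInv := by
  classical
  have fix : ∀ x, x < 5 → (Equiv.swap c n) x = x := fun x hx =>
    Equiv.swap_apply_of_ne_of_ne (by omega) (by omega)
  have hg : ∀ p q, p < 5 → q < 5 → (M.relabel (Equiv.swap c n) hσ).g p q = M.g p q := by
    intro p q hp hq
    show M.g ((Equiv.swap c n).symm p) ((Equiv.swap c n).symm q) = M.g p q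
    rw [Equiv.symm_swap, fix p hp, fix q hq]
  have hty : ∀ p q, p < 5 → q < 5 → (M.relabel (Equiv.swap c n) hσ).ty p q = M.ty p q := by
    intro p q hp hq; unfold KConf.ty; rw [hg p q hp hq]
  obtain ⟨h1, h2, h3⟩ := hI
  refine ⟨?_, ?_, ?_⟩
  · rw [← h1]
    refine Finset.card_bij (fun u _ => (Equiv.swap c n) u) ?_ ?_ ?_
    · intro u hu
      simp only [Finset.mem_filter, Finset.mem_range] at hu ⊢
      obtain ⟨hu12, hu0, hgu⟩ := hu
      refine ⟨(hσ u).2 hu12, fun e => hu0 ?_, ?_⟩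
      · have := congrArg (Equiv.swap c n) e
        rw [Equiv.swap_apply_self, fix 0 (by norm_num)] at this; exact this
      · change M.g ((Equiv.swap c n).symm 0) ((Equiv.swap c n).symm u) = 1 / 2 at hgu
        rw [Equiv.symm_swap, fix 0 (by norm_num)] at hgu
        exact hgu
    · intro u _ u' _ e; exact (Equiv.swap c n).injective e
    · intro w hw
      simp only [Finset.mem_filter, Finset.mem_range] at hw
      refine ⟨(Equiv.swap c n) w, ?_, by rw [Equiv.swap_apply_self]⟩
      simp only [Finset.mem_filter, Finset.mem_range]
      refine ⟨(hσ w).2 hw.1, fun e => hw.2.1 ?_, ?_⟩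
      · have := congrArg (Equiv.swap c n) e
        rw [Equiv.swap_apply_self, fix 0 (by norm_num)] at this; exact this
      · show M.g ((Equiv.swap c n).symm 0) ((Equiv.swap c n).symm ((Equiv.swap c n) w)) = 1 / 2
        rw [Equiv.symm_swap, fix 0 (by norm_num), Equiv.swap_apply_self]; exact hw.2.2
  · intro u w hu hw
    -- long sides of the relabelled structure through `0` are images of long sides through `0`
    have back : ∀ {x : ℕ}, ({0, x} : Finset ℕ) ∈ (M.relabel (Equiv.swap c n) hσ).longSides →
        ({0, (Equiv.swap c n) x} : Finset ℕ) ∈ M.longSides := by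
      intro x hx
      unfold KConf.longSides at hx ⊢
      rw [Finset.mem_filter, KConf.mem_sides] at hx ⊢
      obtain ⟨⟨hc2, t, ht, hsub⟩, p, hp, q, hq, hpq, hgpq⟩ := hx
      change t ∈ M.T.image (relab (Equiv.swap c n)) at ht
      rw [Finset.mem_image] at ht
      obtain ⟨t₀, ht₀, rfl⟩ := ht
      have h0x : (0 : ℕ) ≠ x := by
        intro e; rw [← e] at hc2; simp at hc2
      have hx0 : (Equiv.swap c n) x ≠ 0 := by
        intro e; apply h0x
        have := congrArg (Equiv.swap c n) e
        rw [Equiv.swap_apply_self, fix 0 (by norm_num)] at this; exact this.symm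
      refine ⟨⟨by rw [Finset.card_pair (Ne.symm hx0)], t₀, ht₀, ?_⟩, 0, by simp, (Equiv.swap c n) x, by simp, Ne.symm hx0, ?_⟩
      · intro y hy
        simp only [Finset.mem_insert, Finset.mem_singleton] at hy
        rcases hy with rfl | rfl
        · have := hsub (show (0 : ℕ) ∈ ({0, x} : Finset ℕ) by simp)
          rw [mem_relab_iff, Equiv.symm_swap, fix 0 (by norm_num)] at this; exact this
        · have := hsub (show x ∈ ({0, x} : Finset ℕ) by simp)
          rw [mem_relab_iff, Equiv.symm_swap] at this; exact this
      · -- the long pair is `{0, x}` in some order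
        simp only [Finset.mem_insert, Finset.mem_singleton] at hp hq
        change M.g ((Equiv.swap c n).symm p) ((Equiv.swap c n).symm q) ≠ 1 / 2 at hgpq
        rw [Equiv.symm_swap] at hgpq
        rcases hp with rfl | rfl <;> rcases hq with rfl | rfl
        · exact absurd rfl hpq
        · rw [fix 0 (by norm_num)] at hgpq; exact hgpq
        · rw [fix 0 (by norm_num), M.g_symm] at hgpq; exact hgpq
        · exact absurd rfl hpq
    have := h2 _ _ (back hu) (back hw)
    exact (Equiv.swap c n).injective this
  · rw [hty 0 4 (by norm_num) (by norm_num), hty 0 3 (by norm_num) (by norm_num), hty 2 4 (by norm_num) (by norm_num),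
      hty 1 3 (by norm_num) (by norm_num)]
    exact h3

/-- **Membership in `kidsAt`**: the child with given admissible labels that is not count-killed.
[folklore] -/
theorem mem_kidsAt {s s' : St} {v a c r1 r2 : ℕ} (hadd : s.addTri v a c = some s') (h1 : r1 ∈ s.labelOpts v c)
    (h2 : r2 ∈ s.labelOpts a c) (hk : ((s'.sdom v c r1).sdom a c r2).countKill v a c = false) :
    (((s'.sdom v c r1).sdom a c r2), [v, a, c]) ∈ s.kidsAt v a c := by
  unfold St.kidsAt
  rw [hadd]
  simp only [List.mem_flatMap, List.mem_filterMap]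
  exact ⟨r1, h1, r2, h2, by rw [hk]; simp⟩

/-- **Soundness of the search.**  If `s.search dirty fuel = true` for a state realized by a
structure `M` satisfying the root normalisation, in which the labels `0, …, 4` are used, then
the contact graph of `M` is FCC or HCP. [cite: Hales2012, Theorem 3 and Lemma 9] -/
theorem search_sound : ∀ (fuel : ℕ) (M : KConf) (s : St) (dirty : List ℕ), Realizes M s → M.RootInv →
    (∀ x, x < 5 → ∃ t ∈ s.tris.toList, x ∈ tset t) → s.search dirty fuel = true → M.Concl
  | 0, M, s, dirty, _, _, _, h => by unfold St.search at h; cases h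
  | fuel + 1, M, s, dirty, hR, hI, hU5, h => by
    classical
    unfold St.search at h
    revert h
    unfold St.expand
    obtain ⟨n1, k1⟩ := propagateWL_sound 400 dirty s hR
    cases hp : s.propagateWL 400 dirty with
    | none => exact absurd hp n1
    | some s₁ =>
      obtain ⟨hR1, htr1⟩ := k1 s₁ hp
      have hU5' : ∀ x, x < 5 → ∃ t ∈ s₁.tris.toList, x ∈ tset t := by rw [htr1]; exact hU5
      have hne1 : s₁.tris.toList ≠ [] := by
        obtain ⟨t, ht, -⟩ := hU5' 0 (by norm_num)
        exact List.ne_nil_of_mem ht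
      simp only [rootKill_false hR1 hI, Bool.false_eq_true, ↓reduceIte]
      cases hco : s₁.chooseOpen with
      | none =>
        simp only
        have hno : ∀ v, v < 12 → ∀ a, a < 12 → a ≠ v → s₁.gsc v a ≠ 1 :=
          fun v hv a ha hav => chooseOpen_none hR1 hco hv ha hav
        have hall : ∀ t'' ∈ M.T, ∃ t ∈ s₁.tris.toList, tset t = t'' := fun t'' hT => all_placed_of_no_open hR1 hno hne1 hT
        obtain ⟨hsz, hnu⟩ := size_and_nused_of_complete hR1 hall
        simp only [hsz, hnu, bne_self_eq_false, Bool.or_self, Bool.false_eq_true, ↓reduceIte]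
        by_cases hacc : s₁.accept = true
        · intro _; exact accept_sound hR1 hall hacc
        · simp only [hacc, Bool.false_eq_true, ↓reduceIte]
          intro h; exact (refute_sound 40 s₁ hR1 h).elim
      | some p =>
        obtain ⟨v, a, b⟩ := p
        simp only
        obtain ⟨hv, ha, hav, h1, t₀, ht₀, hset₀, hb, hbv, hba⟩ := chooseOpen_some hR1 hco
        obtain ⟨c, hc, hcv, hca, hcb, hT, hun⟩ := exists_third hR1 hv ha hav h1 ht₀ hset₀
        have hsz : ¬ 20 ≤ s₁.tris.size := not_le.2 (size_lt_of_unplaced hR1 hT hun)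
        rw [if_neg hsz]
        simp only [List.all_eq_true, List.mem_append, List.mem_flatMap, List.mem_filter, List.mem_range, Bool.not_eq_true',
          Bool.or_eq_false_iff, beq_eq_false_iff_ne, ne_eq, decide_eq_false_iff_not, not_le]
        intro hkids
        have hlab : s₁.gdom v a ≠ UNL :=
          hR1.side_lab t₀ ht₀ v (by rw [hset₀]; simp) a (by rw [hset₀]; simp) (Ne.symm hav)
        -- the growth step at an admissible third vertex `c'` in a structure `M'` realizing `s₁`
        have grow : ∀ (M' : KConf) (c' : ℕ), Realizes M' s₁ → M'.RootInv → c' < 12 → c' ≠ v → c' ≠ a →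
            ({v, a, c'} : Finset ℕ) ∈ M'.T → (∀ t ∈ s₁.tris.toList, tset t ≠ {v, a, c'}) →
            (∀ q ∈ s₁.kidsAt v a c', q.1.search q.2 fuel = true) → M'.Concl := by
          intro M' c' hR' hI' hc' hc'v hc'a hT' hun' hstep
          obtain ⟨s', hadd, hR'', htris', -, -⟩ := realizes_grow hR' hv ha hc' (Ne.symm hav) (Ne.symm hc'v) (Ne.symm hc'a)
            hT' hun' hlab
          have m1 := trueCode_mem_labelOpts hR' hv hc' (Ne.symm hc'v) hT' (by simp) (by simp)
          have m2 := trueCode_mem_labelOpts hR' ha hc' (Ne.symm hc'a) hT' (by simp) (by simp)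
          have hk := countKill_false hR'' hI' hv ha hc'
          have h := hstep _ (mem_kidsAt hadd m1 m2 hk)
          exact search_sound fuel M' _ [v, a, c'] hR'' hI' (fun x hx => by
            obtain ⟨t, ht, hxt⟩ := hU5' x hx
            exact ⟨t, by simp [htris', ht], hxt⟩) h
        by_cases hused : s₁.hdeg2 c = 0
        · -- `c` unused: relabel through the smallest unused label `n`
          cases hnl : s₁.newLabel with
          | none => exact absurd hused (newLabel_none hnl hc)
          | some n =>
            obtain ⟨hn, hn0⟩ := newLabel_some hnl
            have hcu : ∀ t ∈ s₁.tris.toList, c ∉ tset t := fun t ht hct =>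
              (used_iff_hdeg2 hR1 hc).1 ⟨t, ht, hct⟩ hused
            have hnu : ∀ t ∈ s₁.tris.toList, n ∉ tset t := fun t ht hnt =>
              (used_iff_hdeg2 hR1 hn).1 ⟨t, ht, hnt⟩ hn0
            have hc5 : 5 ≤ c := by
              by_contra h; push Not at h
              obtain ⟨t, ht, hct⟩ := hU5' c h; exact hcu t ht hct
            have hn5 : 5 ≤ n := by
              by_contra h; push Not at h
              obtain ⟨t, ht, hnt⟩ := hU5' n h; exact hnu t ht hnt
            have hvu : ∃ t ∈ s₁.tris.toList, v ∈ tset t := ⟨t₀, ht₀, by rw [hset₀]; simp⟩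
            have hau : ∃ t ∈ s₁.tris.toList, a ∈ tset t := ⟨t₀, ht₀, by rw [hset₀]; simp⟩
            have hnv : n ≠ v := by rintro rfl; obtain ⟨t, ht, h⟩ := hvu; exact hnu t ht h
            have hna : n ≠ a := by rintro rfl; obtain ⟨t, ht, h⟩ := hau; exact hnu t ht h
            have hσ : ∀ x, (Equiv.swap c n) x < 12 ↔ x < 12 := by
              intro x
              by_cases e1 : x = c
              · subst e1; rw [Equiv.swap_apply_left]; exact ⟨fun _ => hc, fun _ => hn⟩
              · by_cases e2 : x = n
                · subst e2; rw [Equiv.swap_apply_right]; exact ⟨fun _ => hn, fun _ => hc⟩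
                · rw [Equiv.swap_apply_of_ne_of_ne e1 e2]
            have hR' : Realizes (M.relabel (Equiv.swap c n) hσ) s₁ := realizes_swap hR1 hc hn hcu hnu
            have hI' := rootInv_relabel_swap M hc5 hn5 hσ hI
            refine KConf.concl_of_relabel M _ hσ (grow _ n hR' hI' hn hnv hna ?_ ?_ fun q hq => hkids q (Or.inr ?_))
            · show ({v, a, n} : Finset ℕ) ∈ M.T.image (relab (Equiv.swap c n))
              rw [Finset.mem_image]
              refine ⟨{v, a, c}, hT, ?_⟩
              unfold relab
              have e1 : (Equiv.swap c n) v = v := Equiv.swap_apply_of_ne_of_ne (Ne.symm hcv) (Ne.symm hnv)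
              have e2 : (Equiv.swap c n) a = a := Equiv.swap_apply_of_ne_of_ne (Ne.symm hca) (Ne.symm hna)
              have e3 : (Equiv.swap c n) c = n := Equiv.swap_apply_left _ _
              simp [Finset.image_insert, Finset.image_singleton, e1, e2, e3]
            · intro t ht e
              exact hnu t ht (by rw [e]; simp)
            · rw [hnl]; exact hq
        · -- `c` used: the old-label branch
          have g1 : s₁.gsc v c < 2 := by
            by_contra h2; push Not at h2
            have h2' : s₁.gsc v c = 2 := le_antisymm (gsc_le_two hR1 hv hc (Ne.symm hcv)) h2
            obtain ⟨t, ht, e⟩ := placed_of_gsc_two hR1 hv hc (Ne.symm hcv) h2' hT (by simp) (by simp)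
            exact hun t ht e
          have g2 : s₁.gsc a c < 2 := by
            by_contra h2; push Not at h2
            have h2' : s₁.gsc a c = 2 := le_antisymm (gsc_le_two hR1 ha hc (Ne.symm hca)) h2
            obtain ⟨t, ht, e⟩ := placed_of_gsc_two hR1 ha hc (Ne.symm hca) h2' hT (by simp) (by simp)
            exact hun t ht e
          exact grow M c hR1 hI hc hcv hca hT hun fun q hq =>
            hkids q (Or.inl ⟨c, ⟨hc, ⟨⟨⟨⟨hcv, hca⟩, hcb⟩, hused⟩, g1⟩, g2⟩, hq⟩)

/-! ### Part D. Frontiers and parts -/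

/-- **One level**: if every node of `stepAll L` searches `true` with fuel `f`, every node of
`L` searches `true` with fuel `f + 1`. [folklore] -/
theorem stepAll_sound : ∀ (L L' : List (St × List ℕ)) (f : ℕ), stepAll L = some L' →
    (∀ q ∈ L', q.1.search q.2 f = true) → ∀ p ∈ L, p.1.search p.2 (f + 1) = true
  | [], L', f, _, _ => by simp
  | p :: rest, L', f, h, hL' => by
    intro q hq
    unfold stepAll at h
    rcases List.mem_cons.1 hq with rfl | hq
    · -- the head
      unfold St.search
      revert h
      cases he : q.1.expand q.2 with
      | leaf b =>
        cases b
        · intro h; cases h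
        · intro _; rfl
      | branch kids =>
        intro h
        simp only
        rw [List.all_eq_true]
        intro k hk
        revert h
        cases hs : stepAll rest with
        | none => intro h; cases h
        | some L'' =>
          intro h
          simp only [Option.map_some, Option.some.injEq] at h
          exact hL' k (by rw [← h]; exact List.mem_append_left _ hk)
    · -- the tail
      revert h
      cases he : p.1.expand p.2 with
      | leaf b =>
        cases b
        · intro h; cases h
        · intro h; exact stepAll_sound rest L' f h hL' q hq
      | branch kids =>
        cases hs : stepAll rest with
        | none => intro h; cases h
        | some L'' =>
          intro h
          simp only [Option.map_some, Option.some.injEq] at h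
          exact stepAll_sound rest L'' f hs (fun r hr => hL' r (by rw [← h]; exact List.mem_append_right _ hr)) q hq

/-- **Frontiers**: if every node of the frontier at depth `k` searches `true` with fuel `f`,
every start node searches `true` with fuel `f + k`. [folklore] -/
theorem frontier_sound : ∀ (k : ℕ) (L L' : List (St × List ℕ)) (f : ℕ), frontier L k = some L' →
    (∀ q ∈ L', q.1.search q.2 f = true) → ∀ p ∈ L, p.1.search p.2 (f + k) = true
  | 0, L, L', f, h, hL' => by
    unfold frontier at h
    cases h
    simpa using hL'
  | k + 1, L, L', f, h, hL' => by
    unfold frontier at h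
    revert h
    cases hs : stepAll L with
    | none => intro h; cases h
    | some L₁ =>
      intro h
      have h1 := frontier_sound k L₁ L' f h hL'
      have := stepAll_sound L L₁ (f + k) hs h1
      rwa [show f + (k + 1) = f + k + 1 by omega]

/-- Membership in `indexed`. [folklore] -/
theorem mem_indexed_of_mem {α : Type} {L : List α} {x : α} (h : x ∈ L) : ∃ j, (j, x) ∈ indexed L := by
  unfold indexed
  obtain ⟨j, hj, rfl⟩ := List.getElem_of_mem h
  refine ⟨j, ?_⟩
  rw [List.mem_iff_getElem]
  refine ⟨j, by simp [hj], ?_⟩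
  simp

/-- **All parts together decide every root.** [folklore] -/
theorem search_roots_of_parts {depth parts fuel : ℕ} (hparts : 0 < parts)
    (h : ∀ i, i < parts → checkPart depth parts i fuel = true) :
    ∀ p ∈ rootStates, p.1.search p.2 (fuel + depth) = true := by
  have h0 := h 0 hparts
  unfold checkPart at h0
  revert h0
  cases hf : frontier rootStates depth with
  | none => intro h0; cases h0
  | some L =>
    intro _
    refine frontier_sound depth rootStates L fuel hf fun q hq => ?_
    obtain ⟨j, hj⟩ := mem_indexed_of_mem hq
    have hi := h (j % parts) (Nat.mod_lt _ hparts)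
    unfold checkPart at hi
    rw [hf] at hi
    simp only [List.all_eq_true] at hi
    have := hi (j, q) hj
    simpa using this

end Search

end KissingSearch

end Literature.Geometry.DiscreteGeometry
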